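import Literature.NumberTheory.Automorphic.QuadraticBaseChangeFrobCompatibleCarayolProofs
import Literature.NumberTheory.Automorphic.QuadraticBaseChangeNonSelfTwistProofs
import Literature.NumberTheory.Automorphic.BaseChangeCyclicCuspidal
import Literature.NumberTheory.Automorphic.BaseChangeStrongUnramified
import Literature.NumberTheory.Automorphic.BaseChangeGLnProofs
import Literature.NumberTheory.Automorphic.GLnAdelicStructureProofs
import Literature.NumberTheory.GaloisRepresentations.InertiaTwoQuadraticFields
import Literature.NumberTheory.GaloisRepresentations.LAdicCharacterIdelicProofs
import Literature.NumberTheory.NumberFields.ScholzKummerGenerator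
import Mathlib.Algebra.QuadraticAlgebra.Basic
import Mathlib.NumberTheory.LSeries.PrimesInAP
import Mathlib.NumberTheory.NumberField.CMField
import HarnessLib

/-!
# Frobenius compatibility of quadratic base change at the places over ramified primes, III:
# the auxiliary real quadratic field

Topic `Literature/NumberTheory/Automorphic`; fourth *proofs* file (theorems only — no definition,
no named fact) of the seat of `Langlands1980_quadraticBaseChange_frobCompatible`
(`QuadraticBaseChangeFrobCompatible`), continuing `…Proofs`, `…CarayolProofs` (Case A: the prime
`ℓ` below `w` unramified in `F`; and `F` real with `ρ|_{Γ_F}` irreducible) and the support files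
`GaloisRepresentations/InertiaTwoQuadraticFields`, `QuadraticBaseChangeNonSelfTwistProofs`.

**Case B (`ℓ` ramified in `F`, e.g. `F` imaginary quadratic).**  Carayol's theorem (the inline
hypothesis `hCar` of `…CarayolProofs`, Galois-unramified ⇒ automorphic-unramified over TOTALLY
REAL fields) is not available over `F`, and over `ℚ` the representation `ρ` IS ramified at `ℓ`.
The way out is an auxiliary REAL quadratic field `F₁` with the same completion at `ℓ` as `F`
(`F = ℚ(√c)`, `F₁ = ℚ(√(c m))` with `m ≡ 1 (mod 4)` an `ℓ`-adic unit, so that the biquadratic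
`M = F F₁ = F(√m) = F₁(√m)` is unramified over `F` and over `F₁` above `ℓ`):

1. `ρ|_{Γ_{F₁}}` is unramified above `ℓ` (the inertia groups of `Γ_ℚ` above `ℓ` meet `Γ_F` and
   `Γ_{F₁}` in the same subgroup: `InertiaTwoQuadraticFields`);
2. by Case "real `F`" over `F₁` (Carayol over `F₁`, lang.S27, cuspidal base change
   `P₁ = BC_{F₁/ℚ}(π)` of `baseChange_cyclic_cuspidal`), `P₁` is unramified above `ℓ`;
3. `𝒫 = BC_{M/F}(P)` (cuspidal, `baseChange_cyclic_cuspidal` again) is also a weak base change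
   of `P₁` along `M/F₁` (`IsWeakBaseChangeLiftAE.of_isWeakBaseChangeLiftAE_left`), hence
   unramified above `ℓ` by Arthur–Clozel's strong lifting at the places unramified in `M/F₁`
   (`ArthurClozel1989_strongLifting_unramified` (i));
4. `w` being unramified in `M/F`, `P` is unramified at `w` (same fact, (ii): descent of
   unramifiedness), and lang.S27 over `F` (totally real or CM) with Brauer–Nesbitt gives the
   Frobenius polynomial of `ρ|_{Γ_F}` at `w`.

The two applications of `baseChange_cyclic_cuspidal` need `π ≇ π ⊗ η_{F₁}` and
`P ≇ P ⊗ η_{M/F}`, rendered on Satake parameters at an inert place; both come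
(`QuadraticBaseChangeNonSelfTwistProofs`) from ONE element `γ ∈ Γ_F` moving `√m` with
`tr ρ(γ) ≠ 0`, which exists for all but at most four square classes `m` (a `2`-dimensional
semisimple representation has at most four quadratic self-twists) — whence the freedom needed in
the choice of `m = ±q`, `q` prime (Dirichlet).

This file: the automorphic bookkeeping with `F₁`, `M` abstract
(`Langlands1980_quadraticBaseChange_frobCompatible_at_of_auxField`), then the construction of
`F₁ = ℚ(√(c m))`, `M = F(√m)` as Mathlib `QuadraticAlgebra`s with the verification of the Galois
and arithmetic side conditions, Case B (`…_at_of_not_isUnramifiedIn`), and the assembly of the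
named fact from Cases A and B (`Langlands1980_quadraticBaseChange_frobCompatible_of_carayol`:
the fact, granted Carayol's ramification clause `hCar` and the named facts lang.S27,
`ArthurClozel1989_strongLifting_archimedean/unramified`, `baseChange_cyclic_cuspidal`; Case A is
re-derived here with the unramified strong lifting, `…_at_of_isUnramifiedIn'`, so that
`ArthurClozel1989_strongLifting_allFinite` is not needed).

## References

* R. P. Langlands, *Base change for GL(2)*, Ann. of Math. Stud. 96 (1980), §2 (A), (F), (i).
  [LanglandsBaseChange1980]
* H. Carayol, *Sur les représentations ℓ-adiques associées aux formes modulaires de Hilbert*,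
  Ann. Sci. ÉNS 19 (1986), Thm. (A) (pp. 410–411) with §0.5. [CarayolASENS1986]
* J. Arthur, L. Clozel, *Simple algebras, base change, and the advanced theory of the trace
  formula*, Ann. of Math. Stud. 120 (1989), Ch. 3 Thm. 4.2, Thm. 5.1, §6 proof of Lemma 6.3.
  [ArthurClozelAMS120]
* K. A. Ribet, *Galois representations attached to eigenforms with Nebentypus*, LNM 601 (1977),
  §4. [Ribet1977Nebentypus]
* J. Neukirch, *Algebraic Number Theory* (1999), Ch. I §8–§9. [NeukirchANT1999]
-/

noncomputable section

open scoped MatrixGroups Matrix NumberField Polynomial Classical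
open NumberField IsDedekindDomain Field Polynomial Filter

namespace Literature.NumberTheory.Automorphic

open Literature.NumberTheory.GaloisRepresentations

/-! ## Two weak base changes of the same `π` to a tower are compatible -/

section Bookkeeping

variable {n : ℕ} {F E E' : Type} [Field F] [NumberField F] [Field E] [NumberField E]
  [Field E'] [NumberField E'] [Algebra F E] [Algebra F E'] [Algebra E E'] [IsScalarTower F E E']
  {hF : isCompact_glFiniteIntegralLevel n F} {hE : isCompact_glFiniteIntegralLevel n E}
  {hE' : isCompact_glFiniteIntegralLevel n E'}
  {π : AutomorphicRepData (AutomorphyDatum.gl n F hF)}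
  {P : AutomorphicRepData (AutomorphyDatum.gl n E hE)}
  {P' : AutomorphicRepData (AutomorphyDatum.gl n E' hE')}

/-- **Two weak base-change lifts of `π` to a tower `F ⊆ E ⊆ E'` are compatible** (the lifting
identities (1.1) in a tower; Arthur–Clozel Ch. 3 §6, proof of Lemma 6.3: "by transitivity of the
lifting identities (1.1)"): if `P` on `GL_n(𝔸_E)` and `P'` on `GL_n(𝔸_{E'})` are weak base-change
lifts of `π`, then `P'` is a weak base-change lift of `P`.  At almost every `w' ∣ w ∣ v`:
`t_{P,w} = t_{π,v}^{f(w|v)}` and `t_{P',w'} = t_{π,v}^{f(w'|v)} = (t_{π,v}^{f(w|v)})^{f(w'|w)}`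
(`Ideal.inertiaDeg_tower`; the printed form of (1.1), `isWeakBaseChangeLiftAE_of_eventually_exists`,
absorbs the uniqueness of Satake parameters). [cite: ArthurClozelAMS120, Ch. 3, §6, proof of Lemma 6.3] -/
theorem IsWeakBaseChangeLiftAE.of_isWeakBaseChangeLiftAE_left (h : IsWeakBaseChangeLiftAE π P)
    (h' : IsWeakBaseChangeLiftAE π P') : IsWeakBaseChangeLiftAE P P' := by
  apply isWeakBaseChangeLiftAE_of_eventually_exists
  filter_upwards [eventually_under (E := E') h.eventually_exists, h'] with w' hw hw'
  obtain ⟨α, hα, hP⟩ := hw (w'.under (𝓞 E)) rfl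
  refine ⟨_, hP, ?_⟩
  have hwv : w'.asIdeal.under (𝓞 F) = ((w'.under (𝓞 E)).under (𝓞 F)).asIdeal := by
    change w'.asIdeal.under (𝓞 F) = (w'.asIdeal.under (𝓞 E)).under (𝓞 F)
    rw [Ideal.under_under]
  have hP' := hw' ((w'.under (𝓞 E)).under (𝓞 F)) α hwv hα
  rw [Multiset.map_map]
  haveI : w'.asIdeal.LiesOver (w'.under (𝓞 E)).asIdeal := ⟨rfl⟩
  convert hP' using 2
  simp only [Function.comp_apply]
  rw [← pow_mul, ← Ideal.inertiaDeg_tower]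

end Bookkeeping

/-! ## Case B with the auxiliary fields abstract -/

section AuxField

/- Carayol's ramification clause (C), as in `…CarayolProofs` (verbatim). -/
variable
  (hCar : ∀ {K : Type} [Field K] [NumberField K] (hcpt : isCompact_glFiniteIntegralLevel 2 K),
    IsTotallyReal K →
    ∀ (π : CuspidalAutomorphicRepData 2 K hcpt), π.1.IsRegularAlgebraic →
      ∀ (ℓ : ℕ) [Fact ℓ.Prime] (ι : PadicAlgCl ℓ ≃+* ℂ) (r : FramedGaloisRep K (PadicAlgCl ℓ) 2),
        r.toGaloisRep.IsIrreducible →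
        (∀ v : HeightOneSpectrum (𝓞 K), ((ℓ : ℕ) : 𝓞 K) ∉ v.asIdeal →
          IsGaloisCompatibleAt π.1 ι r v) →
        ∀ w : HeightOneSpectrum (𝓞 K), ((ℓ : ℕ) : 𝓞 K) ∉ w.asIdeal →
          r.IsUnramifiedAt w → π.1.IsUnramifiedAt w)

variable {F : Type} [Field F] [NumberField F] {p : ℕ} [Fact p.Prime]
  {hQ : isCompact_glFiniteIntegralLevel 2 ℚ} {hF : isCompact_glFiniteIntegralLevel 2 F}

omit [Fact p.Prime] in
/-- `(p) ∤ w` in `𝓞 F` implies `(p) ∤ w ∩ 𝓞 ℚ`. [folklore] -/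
private theorem natCast_not_mem_under'' {w : HeightOneSpectrum (𝓞 F)}
    (hwp : (p : 𝓞 F) ∉ w.asIdeal) : ((p : ℕ) : 𝓞 ℚ) ∉ (w.under (𝓞 ℚ)).asIdeal := by
  intro h
  apply hwp
  have h' : algebraMap (𝓞 ℚ) (𝓞 F) (p : 𝓞 ℚ) ∈ w.asIdeal := Ideal.mem_comap.mp h
  rwa [map_natCast] at h'

omit [Fact p.Prime] in
/-- `(p) ∤ u ∩ 𝓞 ℚ` implies `(p) ∤ u`, for a place `u` of any number field `K`. [folklore] -/
private theorem natCast_not_mem_of_under {K : Type} [Field K] [NumberField K]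
    {u : HeightOneSpectrum (𝓞 K)} {v : HeightOneSpectrum (𝓞 ℚ)}
    (hu : u.asIdeal.under (𝓞 ℚ) = v.asIdeal) (hv : ((p : ℕ) : 𝓞 ℚ) ∉ v.asIdeal) :
    (p : 𝓞 K) ∉ u.asIdeal := by
  intro h
  apply hv
  rw [← hu, Ideal.under, Ideal.mem_comap, map_natCast]
  exact h

/-- An irreducible framed Galois representation over a field is semisimple. [folklore] -/
private theorem isSemisimple_of_isIrreducible' {K : Type} [Field K] {k : Type*} [Field k]
    [TopologicalSpace k] [IsTopologicalRing k] {n : ℕ} (ρ : FramedGaloisRep K k n)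
    (h : ρ.toGaloisRep.IsIrreducible) : ρ.toGaloisRep.IsSemisimple := by
  haveI : Representation.IsIrreducible ρ.toGaloisRep.toRepresentation := h
  change ComplementedLattice _
  infer_instance

include hCar in
/-- **Case B of the residue, the auxiliary fields being given.**  With the data of
`Langlands1980_quadraticBaseChange_frobCompatible` (`F/ℚ` quadratic, `π`, `T`, `ρ` irreducible and
a.e. compatible, `P` a cuspidal weak base change, `w ∤ p` with `ρ|_{Γ_F}` unramified at `w`),
suppose given a real quadratic field `F₁` and a field `M ⊇ F, F₁`, quadratic over both, such that:
the inertia groups of `Γ_ℚ` above `v = w ∩ ℤ` meet `res(Γ_{F₁})` inside `res(Γ_F)` (`hI`); `w` is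
the only place of `F` above `v` (`huniq`); some `g ∈ Γ_ℚ ∖ res(Γ_{F₁})` has `tr ρ(g) ≠ 0` (`hg`);
some `γ ∈ Γ_F ∖ res(Γ_M)` has `tr ρ(γ) ≠ 0` (`hγ`); `w` is unramified in `M`, and so is every place
of `F₁` above `v` (`hwM`, `huM`).  Then, granted Carayol's clause (C), lang.S27, Arthur–Clozel's
archimedean lifting, cuspidal cyclic base change and the unramified strong lifting, `P` has a
Satake parameter `α` at `w` and the arithmetic Frobenii of `ρ|_{Γ_F}` at `w` have characteristic
polynomial `arithFrobPolyOfSatake ι q_w 1 α` (steps 1–4 of the module docstring).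
[cite: LanglandsBaseChange1980, §2 (A), (F) (pp. 19–20)]
[cite: ArthurClozelAMS120, Ch. 3 Thm. 4.2 (a), Thm. 5.1, §6 proof of Lemma 6.3]
[cite: CarayolASENS1986, Thm. (A) (pp. 410–411) with §0.5] -/
theorem Langlands1980_quadraticBaseChange_frobCompatible_at_of_auxField
    (h27 : exists_galoisRep_of_regularAlgebraic) (hArch : ArthurClozel1989_strongLifting_archimedean)
    (hBCc : baseChange_cyclic_cuspidal) (hACu : ArthurClozel1989_strongLifting_unramified)
    (hF2 : Module.finrank ℚ F = 2) (hFK : IsTotallyReal F ∨ IsCMField F) (ι : PadicAlgCl p ≃+* ℂ)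
    (π : CuspidalAutomorphicRepData 2 ℚ hQ) {T : InfinityType ℚ 2} (hT : π.1.HasInfinityType T)
    (hTL : T.IsLAlgebraic) (hTR : T.IsRegular) (ρ : FramedGaloisRep ℚ (PadicAlgCl p) 2)
    (hirr : ρ.toGaloisRep.IsIrreducible)
    (hρ : ∀ᶠ v : HeightOneSpectrum (𝓞 ℚ) in cofinite,
      ∃ α : Multiset ℂ, π.1.HasSatakeParamAt v α ∧ ρ.IsUnramifiedAt v ∧
        ρ.HasFrobCharpolyAt v (arithFrobPolyOfSatake ι v.residueCard 1 α))
    (P : CuspidalAutomorphicRepData 2 F hF) (hBC : IsWeakBaseChangeLiftAE π.1 P.1)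
    (w : HeightOneSpectrum (𝓞 F)) (hwp : (p : 𝓞 F) ∉ w.asIdeal)
    (hunr : (ρ.restrictField F).IsUnramifiedAt w)
    (F₁ : Type) [Field F₁] [NumberField F₁] (hF₁2 : Module.finrank ℚ F₁ = 2)
    (hF₁R : IsTotallyReal F₁) (M : Type) [Field M] [NumberField M] [Algebra F M] [Algebra F₁ M]
    [IsScalarTower ℚ F₁ M] (hFM : Module.finrank F M = 2) (hF₁M : Module.finrank F₁ M = 2)
    (hI : ∀ 𝔓 ∈ (w.under (𝓞 ℚ)).primesAbove,
      𝔓.inertia (absoluteGaloisGroup ℚ) ⊓ (absGaloisRestrict ℚ F₁).range ≤ (absGaloisRestrict ℚ F).range)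
    (huniq : ∀ w' : HeightOneSpectrum (𝓞 F), w'.asIdeal.under (𝓞 ℚ) = (w.under (𝓞 ℚ)).asIdeal → w' = w)
    (hg : ∃ g : absoluteGaloisGroup ℚ, g ∉ (absGaloisRestrict ℚ F₁).range ∧ FramedRep.trace ρ g ≠ 0)
    (hγ : ∃ γ : absoluteGaloisGroup F,
      γ ∉ (absGaloisRestrict F M).range ∧ FramedRep.trace (ρ.restrictField F) γ ≠ 0)
    (hwM : Algebra.IsUnramifiedIn (𝓞 M) w.asIdeal)
    (huM : ∀ u : HeightOneSpectrum (𝓞 F₁), u.asIdeal.under (𝓞 ℚ) = (w.under (𝓞 ℚ)).asIdeal →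
      Algebra.IsUnramifiedIn (𝓞 M) u.asIdeal) :
    ∃ α : Multiset ℂ, P.1.HasSatakeParamAt w α ∧ (ρ.restrictField F).IsUnramifiedAt w ∧
      (ρ.restrictField F).HasFrobCharpolyAt w (arithFrobPolyOfSatake ι w.residueCard 1 α) := by
  -- degrees, Galois groups
  haveI : Algebra.IsQuadraticExtension ℚ F := ⟨hF2⟩
  haveI : IsGalois ℚ F := inferInstance
  have hprime : (Module.finrank ℚ F).Prime := hF2 ▸ Nat.prime_two
  haveI : IsCyclic (F ≃ₐ[ℚ] F) :=
    isCyclic_of_prime_card (p := Module.finrank ℚ F) (hp := ⟨hprime⟩) (IsGalois.card_aut_eq_finrank ℚ F)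
  haveI : Algebra.IsQuadraticExtension ℚ F₁ := ⟨hF₁2⟩
  haveI : IsGalois ℚ F₁ := inferInstance
  have hprime₁ : (Module.finrank ℚ F₁).Prime := hF₁2 ▸ Nat.prime_two
  haveI : FiniteDimensional F M := Module.finite_of_finrank_pos (by rw [hFM]; exact two_pos)
  haveI : Algebra.IsQuadraticExtension F M := ⟨hFM⟩
  haveI : IsGalois F M := inferInstance
  have hprimeM : (Module.finrank F M).Prime := hFM ▸ Nat.prime_two
  haveI : FiniteDimensional F₁ M := Module.finite_of_finrank_pos (by rw [hF₁M]; exact two_pos)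
  haveI : Algebra.IsQuadraticExtension F₁ M := ⟨hF₁M⟩
  haveI : IsGalois F₁ M := inferInstance
  have hprimeM₁ : (Module.finrank F₁ M).Prime := hF₁M ▸ Nat.prime_two
  have hvp : ((p : ℕ) : 𝓞 ℚ) ∉ (w.under (𝓞 ℚ)).asIdeal := natCast_not_mem_under'' hwp
  -- (1) the cuspidal base change `P₁` of `π` to `F₁`, and `ρ|_{Γ_{F₁}}` irreducible
  obtain ⟨g, hg, hgtr⟩ := hg
  have hirr₁ : (ρ.restrictField F₁).toGaloisRep.IsIrreducible :=
    ρ.isIrreducible_restrictField_of_trace_ne_zero F₁ hF₁2 hirr hg hgtr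
  have hne₁ := exists_inert_hasSatakeParamAt_map_ne_of_trace_ne_zero F₁ hF₁2 ι π.1 ρ hρ ⟨g, hg, hgtr⟩
  obtain ⟨P₁, hBC₁⟩ := hBCc 2 ℚ F₁ hprime₁ hQ π hne₁ (isCompact_glFiniteIntegralLevel_holds 2 F₁)
  -- (2) `P₁` is unramified at every place `u` of `F₁` above `v = w ∩ ℤ`
  have hP₁u : ∀ u : HeightOneSpectrum (𝓞 F₁), u.asIdeal.under (𝓞 ℚ) = (w.under (𝓞 ℚ)).asIdeal →
      P₁.1.IsUnramifiedAt u := by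
    intro u hu
    have hunr₁ : (ρ.restrictField F₁).IsUnramifiedAt u :=
      ρ.isUnramifiedAt_restrictField_of_inertia_inf_range_le hI huniq hunr hu
    obtain ⟨α₁, hα₁, -⟩ := Langlands1980_quadraticBaseChange_frobCompatible_at_of_isTotallyReal hCar
      h27 hArch hF₁2 hF₁R ι π hT hTL hTR ρ hirr₁ hρ P₁ hBC₁ u (natCast_not_mem_of_under hu hvp) hunr₁
    exact ⟨α₁, hα₁⟩
  -- (3) the cuspidal base change `𝒫` of `P` to `M`; it is a weak lift of `P₁` along `M/F₁`
  have hρF := eventually_satakeFrobCompatible_restrictField_of_isWeakBaseChangeLiftAE ι 1 π.1 P.1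
    hBC ρ hρ
  have hneM := exists_inert_hasSatakeParamAt_map_ne_of_trace_ne_zero M hFM ι P.1
    (ρ.restrictField F) hρF hγ
  obtain ⟨PM, hBCM⟩ := hBCc 2 F M hprimeM hF P hneM (isCompact_glFiniteIntegralLevel_holds 2 M)
  have hBC₁M : IsWeakBaseChangeLiftAE P₁.1 PM.1 :=
    IsWeakBaseChangeLiftAE.of_isWeakBaseChangeLiftAE_left hBC₁ (hBC.trans hBCM)
  -- `𝒫` is unramified at every place of `M` above `w`
  have hPMω : ∀ ω : HeightOneSpectrum (𝓞 M), ω.asIdeal.under (𝓞 F) = w.asIdeal →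
      PM.1.IsUnramifiedAt ω := by
    intro ω hω
    have hu : (ω.under (𝓞 F₁)).asIdeal.under (𝓞 ℚ) = (w.under (𝓞 ℚ)).asIdeal := by
      change (ω.asIdeal.under (𝓞 F₁)).under (𝓞 ℚ) = w.asIdeal.under (𝓞 ℚ)
      rw [Ideal.under_under, ← hω, Ideal.under_under]
    exact (hACu.isUnramifiedBaseChangeLift hprimeM₁ hBC₁M).isUnramifiedAt rfl (huM _ hu) (hP₁u _ hu)
  -- (4) descent: `P` is unramified at `w`; conclusion by lang.S27 over `F`
  obtain ⟨α, hα⟩ : P.1.IsUnramifiedAt w := hACu.isUnramifiedAt_of_forall hprimeM hBCM hwM hPMω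
  have hTP : P.1.HasInfinityType (T.baseChange F) :=
    hArch.hasInfinityType_baseChange inferInstance hprime hBC hT
  have hssF : (ρ.restrictField F).toGaloisRep.IsSemisimple :=
    ρ.isSemisimple_restrictField (isSemisimple_of_isIrreducible' ρ hirr)
  exact ⟨α, hα, hasFrobCharpolyAt_one_of_eventually_of_exists_galoisRep h27 hFK ι P hTP
    hTL.baseChange hTR.baseChange (ρ.restrictField F) hssF hρF hwp hα⟩

end AuxField

end Literature.NumberTheory.Automorphic

/-! ## Arithmetic of quadratic fields: non-squares, signature, unramified `K(√m)` -/

namespace Literature.NumberTheory.GaloisRepresentations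

section Arithmetic

/-- A rational number of `q`-adic valuation `1` is not a square. [folklore] -/
theorem Rat.sq_ne_of_padicValRat_eq_one {q : ℕ} [Fact q.Prime] {n : ℚ} (hn : padicValRat q n = 1)
    (a : ℚ) : a ^ 2 ≠ n := by
  intro h
  have hn0 : n ≠ 0 := by rintro rfl; simp at hn
  have h2 : padicValRat q (a ^ 2) = 2 * padicValRat q a := padicValRat.pow a
  rw [h, hn] at h2
  omega

/-- **`n ∉ F²` for `F = ℚ(√c)` when `v_q(n) = 1` and `v_q(c) = 0`**: writing `x = a + b√c`,
`x² = n` forces `ab = 0`, and neither `a² = n` nor `b² c = n` is possible `q`-adically. [folklore] -/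
theorem sq_ne_algebraMap_of_padicValRat {F : Type*} [Field F] [CharZero F] [Algebra ℚ F]
    (h2 : Module.finrank ℚ F = 2) {θ : F} (hθ : θ ∉ Set.range (algebraMap ℚ F)) {c : ℚ}
    (hc : θ ^ 2 = algebraMap ℚ F c) {q : ℕ} [Fact q.Prime] (hcq : padicValRat q c = 0) {n : ℚ}
    (hn : padicValRat q n = 1) (x : F) : x ^ 2 ≠ algebraMap ℚ F n := by
  intro hx
  have hn0 : n ≠ 0 := by rintro rfl; simp at hn
  obtain ⟨a, b, rfl⟩ := QuadraticFields.Quadratic.exists_eq_add_mul h2 hθ x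
  have hsq := QuadraticFields.Quadratic.add_mul_mul_add_mul hc a b a b
  rw [← sq] at hsq
  rw [hsq] at hx
  have hx' : algebraMap ℚ F (a * a + b * b * c) + algebraMap ℚ F (a * b + b * a) * θ =
      algebraMap ℚ F n + algebraMap ℚ F 0 * θ := by rw [hx, map_zero, zero_mul, add_zero]
  obtain ⟨h1, h2'⟩ := QuadraticFields.Quadratic.ext_add_mul hθ hx'
  have hab : a * b = 0 := by linear_combination h2' / 2
  rcases mul_eq_zero.mp hab with ha | hb
  · rw [ha] at h1
    simp only [mul_zero, zero_add] at h1
    have hb : b ≠ 0 := by rintro rfl; exact hn0 (by rw [← h1]; ring)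
    have hc0 : c ≠ 0 := by rintro rfl; exact hn0 (by rw [← h1]; ring)
    have hv : padicValRat q (b * b * c) = padicValRat q b + padicValRat q b + padicValRat q c := by
      rw [padicValRat.mul (mul_ne_zero hb hb) hc0, padicValRat.mul hb hb]
    rw [h1, hn, hcq] at hv
    omega
  · rw [hb] at h1
    simp only [mul_zero, zero_mul, add_zero] at h1
    exact Rat.sq_ne_of_padicValRat_eq_one hn a (by rw [sq]; exact h1)

/-- `v_q(ε q) = 1` for `ε = ±1`. [folklore] -/
theorem padicValRat_sign_mul_self {q : ℕ} [hq : Fact q.Prime] {ε : ℤ} (hε : ε = 1 ∨ ε = -1) :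
    padicValRat q ((ε * q : ℤ) : ℚ) = 1 := by
  have h1 : padicValRat q (q : ℚ) = 1 := padicValRat.self hq.out.one_lt
  rcases hε with rfl | rfl
  · rw [one_mul, Int.cast_natCast]
    exact h1
  · rw [neg_one_mul, Int.cast_neg, Int.cast_natCast, padicValRat.neg]
    exact h1

/-- `v_q(c) = 0` for a rational `c` whose numerator and denominator are smaller than `q`. [folklore] -/
theorem padicValRat_eq_zero_of_lt {q : ℕ} [Fact q.Prime] {c : ℚ} (hc : c ≠ 0)
    (hnum : c.num.natAbs < q) (hden : c.den < q) : padicValRat q c = 0 := by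
  have hnum0 : c.num ≠ 0 := Rat.num_ne_zero.mpr hc
  have h1 : ¬ (q : ℤ) ∣ c.num := fun h ↦ by
    have h' : q ∣ c.num.natAbs := by
      have := Int.natAbs_dvd_natAbs.mpr h
      rwa [Int.natAbs_natCast] at this
    exact absurd (Nat.le_of_dvd (Int.natAbs_pos.mpr hnum0) h') (not_le.mpr hnum)
  have h2 : ¬ q ∣ c.den := fun h ↦ absurd (Nat.le_of_dvd c.den_pos h) (not_le.mpr hden)
  simp only [padicValRat, padicValInt.eq_zero_of_not_dvd h1, padicValNat.eq_zero_of_not_dvd h2]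
  simp

end Arithmetic

section Signature

variable {F : Type} [Field F] [NumberField F]

/-- **The signature of a quadratic field**: `F = ℚ(√c)` is totally real if `c > 0` and totally
complex (hence CM) if `c < 0` (`d_F = c q²`, `NumberField.exists_discr_eq_mul_sq`, and the sign of
`d_F` is `(-1)^{r₂}`, Mathlib `NumberField.sign_discr`). [folklore] -/
theorem isTotallyReal_or_isCMField_of_finrank_eq_two (h2 : Module.finrank ℚ F = 2) :
    IsTotallyReal F ∨ IsCMField F := by
  obtain ⟨θ, c, hθ, hc⟩ := QuadraticFields.Quadratic.exists_sq_eq_algebraMap (F := ℚ) (K := F) h2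
  obtain ⟨q, hq, hd⟩ := NumberField.exists_discr_eq_mul_sq h2 hθ hc
  have hc0 : c ≠ 0 := QuadraticFields.Quadratic.sq_ne_zero_of_not_mem_range hθ hc
  have hsign := NumberField.sign_discr F
  have hrk := InfinitePlace.card_add_two_mul_card_eq_rank F
  rw [h2] at hrk
  rcases lt_or_gt_of_ne hc0 with hneg | hpos
  · -- `d_F < 0`: one complex place, no real place
    right
    have hdneg : NumberField.discr F < 0 := by
      have : (NumberField.discr F : ℚ) < 0 := by rw [hd]; exact mul_neg_of_neg_of_pos hneg (by positivity)
      exact_mod_cast this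
    rw [Int.sign_eq_neg_one_of_neg hdneg] at hsign
    have hodd : Odd (InfinitePlace.nrComplexPlaces F) := by
      by_contra h
      rw [Nat.not_odd_iff_even] at h
      rw [h.neg_one_pow] at hsign
      norm_num at hsign
    obtain ⟨m, hm⟩ := hodd
    have hr : InfinitePlace.nrRealPlaces F = 0 := by omega
    haveI : IsTotallyComplex F := nrRealPlaces_eq_zero_iff.mp hr
    haveI : Algebra.IsQuadraticExtension ℚ F := ⟨h2⟩
    exact IsCMField.ofCMExtension ℚ F
  · -- `d_F > 0`: no complex place
    left
    have hdpos : 0 < NumberField.discr F := by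
      have : (0 : ℚ) < NumberField.discr F := by rw [hd]; positivity
      exact_mod_cast this
    rw [Int.sign_eq_one_of_pos hdpos] at hsign
    have heven : Even (InfinitePlace.nrComplexPlaces F) := by
      by_contra h
      rw [Nat.not_even_iff_odd] at h
      rw [h.neg_one_pow] at hsign
      norm_num at hsign
    obtain ⟨m, hm⟩ := heven
    have hc' : InfinitePlace.nrComplexPlaces F = 0 := by omega
    exact nrComplexPlaces_eq_zero_iff.mp hc'

/-- A quadratic field `ℚ(√c)` with `c > 0` is totally real. [folklore] -/
theorem isTotallyReal_of_sq_eq_of_pos (h2 : Module.finrank ℚ F = 2) {θ : F}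
    (hθ : θ ∉ Set.range (algebraMap ℚ F)) {c : ℚ} (hc : θ ^ 2 = algebraMap ℚ F c) (hpos : 0 < c) :
    IsTotallyReal F := by
  obtain ⟨q, hq, hd⟩ := NumberField.exists_discr_eq_mul_sq h2 hθ hc
  have hsign := NumberField.sign_discr F
  have hrk := InfinitePlace.card_add_two_mul_card_eq_rank F
  rw [h2] at hrk
  have hdpos : 0 < NumberField.discr F := by
    have : (0 : ℚ) < NumberField.discr F := by rw [hd]; positivity
    exact_mod_cast this
  rw [Int.sign_eq_one_of_pos hdpos] at hsign
  have heven : Even (InfinitePlace.nrComplexPlaces F) := by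
    by_contra h
    rw [Nat.not_even_iff_odd] at h
    rw [h.neg_one_pow] at hsign
    norm_num at hsign
  obtain ⟨m, hm⟩ := heven
  have hc' : InfinitePlace.nrComplexPlaces F = 0 := by omega
  exact nrComplexPlaces_eq_zero_iff.mp hc'

end Signature

section UnramifiedSqrt

variable {K : Type} [Field K] [NumberField K]

/-- The norm of the prime of `ℤ` below a place lies in every prime of `\bar ℤ_K` above a place
over it. [folklore] -/
theorem natCast_absNorm_mem_of_mem_primesAbove {u : HeightOneSpectrum (𝓞 K)}
    {v : HeightOneSpectrum (𝓞 ℚ)} (hu : u.asIdeal.under (𝓞 ℚ) = v.asIdeal)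
    {𝔓 : Ideal (absIntegers (𝓞 K) K)} (h𝔓 : 𝔓 ∈ u.primesAbove) :
    (((Ideal.absNorm v.asIdeal : ℕ) : ℤ) : absIntegers (𝓞 K) K) ∈ 𝔓 := by
  have h1 : ((Ideal.absNorm v.asIdeal : ℕ) : 𝓞 ℚ) ∈ v.asIdeal := Ideal.absNorm_mem _
  have h2 : ((Ideal.absNorm v.asIdeal : ℕ) : 𝓞 K) ∈ u.asIdeal := by
    have h : algebraMap (𝓞 ℚ) (𝓞 K) ((Ideal.absNorm v.asIdeal : ℕ) : 𝓞 ℚ) ∈ u.asIdeal := by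
      rw [← Ideal.mem_comap]
      change _ ∈ u.asIdeal.under (𝓞 ℚ)
      rw [hu]
      exact h1
    rwa [map_natCast] at h
  have h3 : algebraMap (𝓞 K) (absIntegers (𝓞 K) K) ((Ideal.absNorm v.asIdeal : ℕ) : 𝓞 K) ∈ 𝔓 := by
    rw [← Ideal.mem_comap]
    have h4 : 𝔓.comap (algebraMap (𝓞 K) (absIntegers (𝓞 K) K)) = u.asIdeal := h𝔓.2.over.symm
    rw [h4]
    exact h2
  rw [map_natCast] at h3
  rwa [Int.cast_natCast]

/-- An integer `m` prime to the norm of the prime of `ℤ` below lies in no prime of `\bar ℤ_K`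
above (Bézout, `intCast_not_mem_of_intCast_mem`). [folklore] -/
theorem intCast_not_mem_of_gcd_eq_one {u : HeightOneSpectrum (𝓞 K)} {v : HeightOneSpectrum (𝓞 ℚ)}
    (hu : u.asIdeal.under (𝓞 ℚ) = v.asIdeal) {m : ℤ} (hm : Int.gcd m (Ideal.absNorm v.asIdeal) = 1)
    {𝔓 : Ideal (absIntegers (𝓞 K) K)} (h𝔓 : 𝔓 ∈ u.primesAbove) :
    ((m : absIntegers (𝓞 K) K)) ∉ 𝔓 := by
  haveI : 𝔓.IsPrime := h𝔓.1
  obtain ⟨a, b, hab⟩ := Int.isCoprime_iff_gcd_eq_one.mpr hm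
  exact intCast_not_mem_of_intCast_mem hab (natCast_absNorm_mem_of_mem_primesAbove hu h𝔓)

/-- **`K(√m)/K` is unramified at the places prime to `m`, for `m ≡ 1 (mod 4)`** — in the form:
if `M/K` is quadratic, generated by `μ` with `μ² = m`, `m = 4k+1`, and `m` lies in no prime of
`\bar ℤ_K` above `v`, then `v` is unramified in `M`.  The inertia groups above `v` fix `e(μ)` for
the embedding `e : M → K̄` (`smul_eq_self_of_mem_inertia_of_sq_eq`), hence fix `e(M)` pointwise,
i.e. die in `Gal(e(M)/K)`; so `v` is unramified in `e(M) ≅ M`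
(`isUnramifiedIn_of_forall_inertia_absRestrictNormalHom_eq_one`). [cite: NeukirchANT1999, Ch. I §8] -/
theorem isUnramifiedIn_of_sq_eq_intCast (M : Type) [Field M] [NumberField M] [Algebra K M]
    (h2 : Module.finrank K M = 2) {μ : M} (hμK : μ ∉ Set.range (algebraMap K M)) {m k : ℤ}
    (hmk : m = 4 * k + 1) (hμ : μ ^ 2 = (m : M)) (v : HeightOneSpectrum (𝓞 K))
    (hm : ∀ 𝔓 ∈ v.primesAbove, ((m : absIntegers (𝓞 K) K)) ∉ 𝔓) :
    Algebra.IsUnramifiedIn (𝓞 M) v.asIdeal := by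
  haveI : FiniteDimensional K M := Module.finite_of_finrank_pos (by rw [h2]; exact two_pos)
  haveI : Algebra.IsQuadraticExtension K M := ⟨h2⟩
  haveI : IsGalois K M := inferInstance
  set e := absEmbedding K M with hedef
  have he := mem_range_absGaloisRestrict_iff_smul_absEmbedding K M
  obtain ⟨L, hLdef⟩ : ∃ L, L = e.fieldRange := ⟨_, rfl⟩
  let e' : M ≃ₐ[K] L := e.equivFieldRange.trans (IntermediateField.equivOfEq hLdef.symm)
  haveI := e'.toLinearEquiv.finiteDimensional
  haveI hGL := IsGalois.of_algEquiv e'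
  haveI : NumberField L := NumberField.of_module_finite K L
  have ht : (e μ) ^ 2 = (m : AlgebraicClosure K) := by rw [← map_pow, hμ, map_intCast]
  have key : ∀ 𝔓 ∈ v.primesAbove, ∀ g ∈ 𝔓.inertia (absoluteGaloisGroup K),
      absRestrictNormalHom L g = 1 := by
    intro 𝔓 h𝔓 g hg
    haveI : 𝔓.IsPrime := h𝔓.1
    have hgt : g • e μ = e μ := smul_eq_self_of_mem_inertia_of_sq_eq hmk ht (hm 𝔓 h𝔓) hg
    have hgr : g ∈ (absGaloisRestrict K M).range :=
      (mem_range_absGaloisRestrict_iff_smul_gen_eq h2 hμK he g).mpr hgt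
    rw [absRestrictNormalHom_eq_one_iff, IntermediateField.mem_fixingSubgroup_iff]
    intro y hy
    rw [hLdef] at hy
    obtain ⟨x, rfl⟩ := AlgHom.mem_fieldRange.mp hy
    have h1 := ((he g).mp hgr) x
    rwa [absoluteGaloisGroup.smul_def] at h1
  have hL := isUnramifiedIn_of_forall_inertia_absRestrictNormalHom_eq_one (L := L) key
  exact NumberFields.isUnramifiedIn_of_algEquiv_of_isUnramifiedIn e' v.ne_bot hL

end UnramifiedSqrt

section TwoRoots

variable {K : Type*} [Field K]

/-- Two square roots of the same non-zero element of a field agree up to sign. [folklore] -/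
theorem eq_or_eq_neg_of_sq_eq_sq' {R : Type*} [Field R] {x y : R} (h : x ^ 2 = y ^ 2) :
    x = y ∨ x = -y :=
  sq_eq_sq_iff_eq_or_eq_neg.mp h

/-- If `γ` negates one square root `t ≠ 0` of an element, it fixes no square root of it. [folklore] -/
theorem absoluteGaloisGroup.smul_ne_of_smul_eq_neg [CharZero K] {γ : absoluteGaloisGroup K}
    {t t' : AlgebraicClosure K} (ht0 : t ≠ 0) (hγ : γ • t = -t) (h : t' ^ 2 = t ^ 2) :
    γ • t' ≠ t' := by
  have hss : t ≠ -t := fun h' ↦ ht0 (by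
    have h2 : (2 : AlgebraicClosure K) * t = 0 := by
      rw [two_mul]; nth_rewrite 2 [h']; exact add_neg_cancel t
    exact (mul_eq_zero.mp h2).resolve_left two_ne_zero)
  rcases eq_or_eq_neg_of_sq_eq_sq' h with rfl | rfl
  · rw [hγ]; exact hss.symm
  · rw [smul_neg, hγ, neg_neg]; exact hss

end TwoRoots

section QuadAlg

variable {K : Type*} [Field K] (a : K)

/-- `ω² = a` in `K[ω]/(ω² - a)` (Mathlib `QuadraticAlgebra K a 0`, `ω = ⟨0, 1⟩`). [folklore] -/
theorem quadAlg_omega_sq :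
    ((⟨0, 1⟩ : QuadraticAlgebra K a 0)) ^ 2 = algebraMap K (QuadraticAlgebra K a 0) a := by
  rw [QuadraticAlgebra.algebraMap_eq, sq, QuadraticAlgebra.mk_mul_mk]
  ext <;> simp

/-- `ω ∉ K`. [folklore] -/
theorem quadAlg_omega_not_mem_range :
    (⟨0, 1⟩ : QuadraticAlgebra K a 0) ∉ Set.range (algebraMap K (QuadraticAlgebra K a 0)) := by
  rintro ⟨r, hr⟩
  have := congrArg QuadraticAlgebra.im hr
  simp [QuadraticAlgebra.algebraMap_eq] at this

/-- Integers of `K[ω]` come from `K`. [folklore] -/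
theorem quadAlg_intCast_eq (n : ℤ) :
    ((n : QuadraticAlgebra K a 0)) = algebraMap K (QuadraticAlgebra K a 0) (n : K) := by
  rw [QuadraticAlgebra.algebraMap_eq]
  ext <;> simp

/-- `(y ω)(y' ω) = a y y'`. [folklore] -/
theorem quadAlg_mk_zero_mul_mk_zero (y y' : K) :
    (⟨0, y⟩ : QuadraticAlgebra K a 0) * ⟨0, y'⟩ = algebraMap K (QuadraticAlgebra K a 0) (a * y * y') := by
  rw [QuadraticAlgebra.algebraMap_eq, QuadraticAlgebra.mk_mul_mk]
  ext <;> simp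

/-- The `ω`-coordinate of `r + s (y ω)` for rational `r`, `s`. [folklore] -/
theorem quadAlg_im_smul_one_add_smul_mk [CharZero K] (r s : ℚ) (y : K) :
    (r • (1 : QuadraticAlgebra K a 0) + s • (⟨0, y⟩ : QuadraticAlgebra K a 0)).im = (s : K) * y := by
  simp [Rat.smul_def, QuadraticAlgebra.im_one]

end QuadAlg

end Literature.NumberTheory.GaloisRepresentations

/-! ## Case B with the concrete auxiliary fields, and the assembly of the named fact -/

namespace Literature.NumberTheory.Automorphic

open Literature.NumberTheory.GaloisRepresentations

section CaseB

variable
  (hCar : ∀ {K : Type} [Field K] [NumberField K] (hcpt : isCompact_glFiniteIntegralLevel 2 K),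
    IsTotallyReal K →
    ∀ (π : CuspidalAutomorphicRepData 2 K hcpt), π.1.IsRegularAlgebraic →
      ∀ (ℓ : ℕ) [Fact ℓ.Prime] (ι : PadicAlgCl ℓ ≃+* ℂ) (r : FramedGaloisRep K (PadicAlgCl ℓ) 2),
        r.toGaloisRep.IsIrreducible →
        (∀ v : HeightOneSpectrum (𝓞 K), ((ℓ : ℕ) : 𝓞 K) ∉ v.asIdeal →
          IsGaloisCompatibleAt π.1 ι r v) →
        ∀ w : HeightOneSpectrum (𝓞 K), ((ℓ : ℕ) : 𝓞 K) ∉ w.asIdeal →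
          r.IsUnramifiedAt w → π.1.IsUnramifiedAt w)

variable {F : Type} [Field F] [NumberField F] {p : ℕ} [Fact p.Prime]
  {hQ : isCompact_glFiniteIntegralLevel 2 ℚ} {hF : isCompact_glFiniteIntegralLevel 2 F}

include hCar in
/-- **Case B of the residue: the fact at every `w ∤ p` over a prime RAMIFIED in `F`** (granted
Carayol's ramification clause (C), lang.S27, Arthur–Clozel's archimedean and unramified strong
lifting, and cuspidal cyclic base change).  With the data of
`Langlands1980_quadraticBaseChange_frobCompatible`, suppose the prime `ℓ = w ∩ ℤ` ramifies in `F`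
(so `w` is the unique place above it).  Write `F = ℚ(√c)`; choose five primes `qⱼ > B`,
`qⱼ ≡ sign c (mod 4)` (Dirichlet), `mⱼ = (sign c) qⱼ ≡ 1 (mod 4)`; by
`FramedGaloisRep.exists_smul_eq_neg_and_trace_ne_zero` some `γ ∈ Γ_F` negates `√mⱼ` with
`tr ρ(γ) ≠ 0` (the `√(mᵢ mⱼ)` are irrational over `F`, `sq_ne_algebraMap_of_padicValRat`); with
this `m = mⱼ` put `F₁ = ℚ(√(c m))` (real quadratic: `c m > 0`) and `M = F(√m)` (Mathlib
`QuadraticAlgebra`), an `F₁`-algebra through `√(c m) ↦ √c · √m`.  The side conditions of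
`Langlands1980_quadraticBaseChange_frobCompatible_at_of_auxField` hold: inertia above `ℓ` fixes
`√m` (`m ≡ 1 (mod 4)`, `(m, ℓ) = 1`: `InertiaTwoQuadraticFields`), `w` and the places of `F₁` above
`ℓ` are unramified in `M` (`isUnramifiedIn_of_sq_eq_intCast`), and `γ` furnishes both non-dihedrality
witnesses. [cite: LanglandsBaseChange1980, §2 (A), (F) (pp. 19–20)]
[cite: ArthurClozelAMS120, Ch. 3 Thm. 4.2 (a), Thm. 5.1] [cite: CarayolASENS1986, Thm. (A) (pp. 410–411) with §0.5] -/
theorem Langlands1980_quadraticBaseChange_frobCompatible_at_of_not_isUnramifiedIn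
    (h27 : exists_galoisRep_of_regularAlgebraic) (hArch : ArthurClozel1989_strongLifting_archimedean)
    (hBCc : baseChange_cyclic_cuspidal) (hACu : ArthurClozel1989_strongLifting_unramified)
    (hF2 : Module.finrank ℚ F = 2) (ι : PadicAlgCl p ≃+* ℂ)
    (π : CuspidalAutomorphicRepData 2 ℚ hQ) {T : InfinityType ℚ 2} (hT : π.1.HasInfinityType T)
    (hTL : T.IsLAlgebraic) (hTR : T.IsRegular) (ρ : FramedGaloisRep ℚ (PadicAlgCl p) 2)
    (hirr : ρ.toGaloisRep.IsIrreducible)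
    (hρ : ∀ᶠ v : HeightOneSpectrum (𝓞 ℚ) in cofinite,
      ∃ α : Multiset ℂ, π.1.HasSatakeParamAt v α ∧ ρ.IsUnramifiedAt v ∧
        ρ.HasFrobCharpolyAt v (arithFrobPolyOfSatake ι v.residueCard 1 α))
    (P : CuspidalAutomorphicRepData 2 F hF) (hBC : IsWeakBaseChangeLiftAE π.1 P.1)
    (w : HeightOneSpectrum (𝓞 F)) (hwp : (p : 𝓞 F) ∉ w.asIdeal)
    (hram : ¬ Algebra.IsUnramifiedIn (𝓞 F) (w.under (𝓞 ℚ)).asIdeal)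
    (hunr : (ρ.restrictField F).IsUnramifiedAt w) :
    ∃ α : Multiset ℂ, P.1.HasSatakeParamAt w α ∧ (ρ.restrictField F).IsUnramifiedAt w ∧
      (ρ.restrictField F).HasFrobCharpolyAt w (arithFrobPolyOfSatake ι w.residueCard 1 α) := by
  -- (0) `F = ℚ(√c)`, Galois of prime degree; `w` is the only place above `v = w ∩ ℤ`
  haveI : Algebra.IsQuadraticExtension ℚ F := ⟨hF2⟩
  haveI : IsGalois ℚ F := inferInstance
  have hprime : (Module.finrank ℚ F).Prime := hF2 ▸ Nat.prime_two
  set v : HeightOneSpectrum (𝓞 ℚ) := w.under (𝓞 ℚ) with hvdef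
  have huniq : ∀ w' : HeightOneSpectrum (𝓞 F), w'.asIdeal.under (𝓞 ℚ) = v.asIdeal → w' = w :=
    fun w' hw' ↦ HeightOneSpectrum.eq_of_not_isUnramifiedIn_of_prime hprime hram hw' rfl
  obtain ⟨θ, c, hθ, hc⟩ := QuadraticFields.Quadratic.exists_sq_eq_algebraMap (F := ℚ) (K := F) hF2
  have hc0 : c ≠ 0 := QuadraticFields.Quadratic.sq_ne_zero_of_not_mem_range hθ hc
  have hθ0 : θ ≠ 0 := QuadraticFields.Quadratic.ne_zero_of_not_mem_range hθ
  have hFK : IsTotallyReal F ∨ IsCMField F := isTotallyReal_or_isCMField_of_finrank_eq_two hF2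
  -- (1) five primes `q ≡ sign c (mod 4)` beyond `B`, and `mⱼ = (sign c) qⱼ = 4k+1`
  set N : ℕ := Ideal.absNorm v.asIdeal with hNdef
  set ε : ℤ := if 0 < c then 1 else -1 with hεdef
  have hε : ε = 1 ∨ ε = -1 := by rw [hεdef]; split_ifs <;> simp
  set a : ZMod 4 := if 0 < c then 1 else 3 with hadef
  have ha : IsUnit a := by
    rw [hadef]
    split_ifs
    · exact isUnit_one
    · exact isUnit_iff_exists_inv.mpr ⟨3, by decide⟩
  set B : ℕ := max N (max c.num.natAbs c.den) with hBdef
  set S : Set ℕ := {q | q.Prime ∧ (q : ZMod 4) = a} ∩ {q | B < q} with hSdef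
  have hSinf : S.Infinite := Set.infinite_of_forall_exists_gt fun n ↦ by
    obtain ⟨q, hq, hqp, hqa⟩ := Nat.forall_exists_prime_gt_and_eq_mod ha (max n B)
    exact ⟨q, ⟨⟨hqp, hqa⟩, lt_of_le_of_lt (le_max_right _ _) hq⟩, lt_of_le_of_lt (le_max_left _ _) hq⟩
  set qs : Fin 5 → ℕ := fun j ↦ (Set.Infinite.natEmbedding S hSinf j).1 with hqsdef
  have hqS : ∀ j, qs j ∈ S := fun j ↦ (Set.Infinite.natEmbedding S hSinf j).2
  have hqinj : Function.Injective qs := fun i j h ↦ by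
    have := (Set.Infinite.natEmbedding S hSinf).injective (Subtype.ext h)
    exact Fin.ext this
  have hqprime : ∀ j, (qs j).Prime := fun j ↦ (hqS j).1.1
  have hqB : ∀ j, B < qs j := fun j ↦ (hqS j).2
  set ms : Fin 5 → ℤ := fun j ↦ ε * qs j with hmsdef
  have hms0 : ∀ j, ms j ≠ 0 := fun j ↦ mul_ne_zero (by rcases hε with h | h <;> simp [h])
    (by exact_mod_cast (hqprime j).ne_zero)
  -- valuations
  have hvq : ∀ j, padicValRat (qs j) ((ms j : ℤ) : ℚ) = 1 := fun j ↦ by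
    haveI : Fact (qs j).Prime := ⟨hqprime j⟩
    exact padicValRat_sign_mul_self hε
  have hvc : ∀ j, padicValRat (qs j) c = 0 := fun j ↦ by
    haveI : Fact (qs j).Prime := ⟨hqprime j⟩
    refine padicValRat_eq_zero_of_lt hc0 ?_ ?_
    · exact lt_of_le_of_lt ((le_max_left _ _).trans (le_max_right _ _)) (hqB j)
    · exact lt_of_le_of_lt ((le_max_right _ _).trans (le_max_right _ _)) (hqB j)
  have hvqq : ∀ i j, i ≠ j → padicValRat (qs i) ((ms i * ms j : ℤ) : ℚ) = 1 := by
    intro i j hij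
    haveI : Fact (qs i).Prime := ⟨hqprime i⟩
    have hne : qs i ≠ qs j := fun h ↦ hij (hqinj h)
    have h0 : ((ms j : ℤ) : ℚ) ≠ 0 := by exact_mod_cast hms0 j
    have h0' : ((ms i : ℤ) : ℚ) ≠ 0 := by exact_mod_cast hms0 i
    have hvj : padicValRat (qs i) ((ms j : ℤ) : ℚ) = 0 := by
      haveI : Fact (qs j).Prime := ⟨hqprime j⟩
      have h1 : padicValRat (qs i) ((qs j : ℕ) : ℚ) = 0 := by
        rw [padicValRat.of_nat]
        exact_mod_cast padicValNat_primes hne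
      rcases hε with h | h
      · simp [hmsdef, h, h1]
      · simp only [hmsdef, h, neg_one_mul, Int.cast_neg, Int.cast_natCast, padicValRat.neg]
        exact h1
    rw [Int.cast_mul (ms i) (ms j), padicValRat.mul h0' h0, hvj, add_zero]
    exact hvq i
  -- (2) the five square roots in `F̄`, and a good one
  have hex : ∀ j, ∃ t : AlgebraicClosure F, t ^ 2 = ((ms j : ℤ) : AlgebraicClosure F) := fun j ↦
    IsAlgClosed.exists_pow_nat_eq _ two_pos
  choose t ht using hex
  have ht0 : ∀ j, t j ≠ 0 := fun j h ↦ by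
    have := ht j
    rw [h, zero_pow two_ne_zero] at this
    exact hms0 j (by exact_mod_cast this.symm)
  have htfix : ∀ j (g : absoluteGaloisGroup F), g • (t j ^ 2) = t j ^ 2 := fun j g ↦ by
    rw [ht j, absoluteGaloisGroup.smul_def, map_intCast]
  have htdist : ∀ i j, i ≠ j → t i * t j ∉ Set.range (algebraMap F (AlgebraicClosure F)) := by
    rintro i j hij ⟨x, hx⟩
    haveI : Fact (qs i).Prime := ⟨hqprime i⟩
    apply sq_ne_algebraMap_of_padicValRat hF2 hθ hc (hvc i) (hvqq i j hij) x
    apply (algebraMap F (AlgebraicClosure F)).injective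
    rw [map_pow, hx, mul_pow, ht i, ht j, map_intCast (algebraMap ℚ F), map_intCast, Int.cast_mul (ms i) (ms j)]
  have hss : ρ.toGaloisRep.IsSemisimple := by
    haveI : Representation.IsIrreducible ρ.toGaloisRep.toRepresentation := hirr
    change ComplementedLattice _
    infer_instance
  have hssF : (ρ.restrictField F).toGaloisRep.IsSemisimple := ρ.isSemisimple_restrictField hss
  obtain ⟨j, γ, hγt, hγtr⟩ := (ρ.restrictField F).exists_smul_eq_neg_and_trace_ne_zero hssF t ht0
    htfix htdist
  -- (3) the chosen `m = 4k + 1`, `q`, and `(m, N) = 1`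
  set m : ℤ := ms j with hmdef
  set q : ℕ := qs j with hqdef
  haveI hqF : Fact q.Prime := ⟨hqprime j⟩
  have hqa : (q : ZMod 4) = a := (hqS j).1.2
  have hm4 : ∃ k : ℤ, m = 4 * k + 1 := by
    have hdm := Nat.div_add_mod q 4
    by_cases hcpos : 0 < c
    · have hε1 : ε = 1 := by rw [hεdef, if_pos hcpos]
      have ha1 : a = 1 := by rw [hadef, if_pos hcpos]
      rw [ha1] at hqa
      have hq4 : q % 4 = 1 := by
        have h := congrArg ZMod.val hqa
        rw [ZMod.val_natCast] at h
        exact h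
      refine ⟨((q / 4 : ℕ) : ℤ), ?_⟩
      change ε * (qs j : ℤ) = _
      rw [hε1, one_mul, ← hqdef]
      omega
    · have hε1 : ε = -1 := by rw [hεdef, if_neg hcpos]
      have ha1 : a = 3 := by rw [hadef, if_neg hcpos]
      rw [ha1] at hqa
      have hq4 : q % 4 = 3 := by
        have h := congrArg ZMod.val hqa
        rw [ZMod.val_natCast] at h
        exact h
      refine ⟨-((q / 4 : ℕ) : ℤ) - 1, ?_⟩
      change ε * (qs j : ℤ) = _
      rw [hε1, neg_one_mul, ← hqdef]
      omega
  obtain ⟨k, hmk⟩ := hm4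
  have htj : t j ^ 2 = (m : AlgebraicClosure F) := by rw [hmdef]; exact ht j
  have hcm : 0 < c * (m : ℚ) := by
    by_cases hcpos : 0 < c
    · have hε1 : ε = 1 := by rw [hεdef, if_pos hcpos]
      have hm : (0 : ℚ) < m := by
        change (0 : ℚ) < ((ε * (qs j : ℤ) : ℤ) : ℚ)
        rw [hε1, one_mul]
        exact_mod_cast (hqprime j).pos
      exact mul_pos hcpos hm
    · have hε1 : ε = -1 := by rw [hεdef, if_neg hcpos]
      have hcneg : c < 0 := lt_of_le_of_ne (not_lt.mp hcpos) hc0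
      have hm : (m : ℚ) < 0 := by
        change ((ε * (qs j : ℤ) : ℤ) : ℚ) < 0
        rw [hε1, neg_one_mul]
        push_cast
        exact neg_neg_of_pos (by exact_mod_cast (hqprime j).pos)
      exact mul_pos_of_neg_of_neg hcneg hm
  have hgcd : Int.gcd m N = 1 := by
    have hN0 : 0 < N := Nat.pos_of_ne_zero fun h ↦ v.ne_bot (Ideal.absNorm_eq_zero_iff.mp h)
    have hqN : ¬ q ∣ N := fun h ↦
      absurd (lt_of_le_of_lt (le_max_left _ _) (hqB j)) (not_lt.mpr (Nat.le_of_dvd hN0 h))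
    have hcop : Nat.Coprime q N := (Nat.Prime.coprime_iff_not_dvd (hqprime j)).mpr hqN
    have h1 : Int.gcd m N = Nat.gcd q N := by
      rcases hε with h | h <;> simp [hmdef, hmsdef, h, Int.gcd_eq_natAbs, hqdef]
    rw [h1]
    exact hcop
  have hmP : ∀ {K : Type} [Field K] [NumberField K] {u : HeightOneSpectrum (𝓞 K)},
      u.asIdeal.under (𝓞 ℚ) = v.asIdeal → ∀ (𝔓 : Ideal (absIntegers (𝓞 K) K)),
        𝔓 ∈ u.primesAbove → ((m : absIntegers (𝓞 K) K)) ∉ 𝔓 :=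
    fun hu 𝔓 h𝔓 ↦ intCast_not_mem_of_gcd_eq_one hu hgcd h𝔓
  -- (4) the fields `F₁ = ℚ(√(c m))` and `M = F(√m)`
  have hD : ∀ r : ℚ, r ^ 2 ≠ c * (m : ℚ) + 0 * r := fun r ↦ by
    rw [zero_mul, add_zero]
    refine Rat.sq_ne_of_padicValRat_eq_one (q := q) ?_ r
    rw [padicValRat.mul hc0 (by exact_mod_cast hms0 j), hvc j, zero_add]
    exact hvq j
  haveI : Fact (∀ r : ℚ, r ^ 2 ≠ c * (m : ℚ) + 0 * r) := ⟨hD⟩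
  let F₁ : Type := QuadraticAlgebra ℚ (c * (m : ℚ)) 0
  haveI : NumberField F₁ := NumberField.mk
  have hF₁2 : Module.finrank ℚ F₁ = 2 := QuadraticAlgebra.finrank_eq_two (c * (m : ℚ)) 0
  set θ₁ : F₁ := ⟨0, 1⟩ with hθ₁def
  have hθ₁sq : θ₁ ^ 2 = algebraMap ℚ F₁ (c * m) := quadAlg_omega_sq (c * (m : ℚ))
  have hθ₁ : θ₁ ∉ Set.range (algebraMap ℚ F₁) := quadAlg_omega_not_mem_range (c * (m : ℚ))
  have hF₁R : IsTotallyReal F₁ := isTotallyReal_of_sq_eq_of_pos hF₁2 hθ₁ hθ₁sq hcm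
  have hMfact : ∀ r : F, r ^ 2 ≠ (m : F) + 0 * r := fun r ↦ by
    rw [zero_mul, add_zero]
    have h := sq_ne_algebraMap_of_padicValRat hF2 hθ hc (hvc j) (hvq j) r
    rwa [map_intCast] at h
  haveI : Fact (∀ r : F, r ^ 2 ≠ (m : F) + 0 * r) := ⟨hMfact⟩
  let M : Type := QuadraticAlgebra F (m : F) 0
  haveI : Module.Finite ℚ M := Module.Finite.trans F M
  haveI : NumberField M := NumberField.mk
  have hFM : Module.finrank F M = 2 := QuadraticAlgebra.finrank_eq_two (m : F) 0
  set μ : M := ⟨0, 1⟩ with hμdef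
  have hμsq : μ ^ 2 = (m : M) := (quadAlg_omega_sq (m : F)).trans (quadAlg_intCast_eq (m : F) m).symm
  have hμF : μ ∉ Set.range (algebraMap F M) := quadAlg_omega_not_mem_range (m : F)
  -- `M` as an `F₁`-algebra: `√(c m) ↦ √c · √m`
  have hθθ : θ * θ = (c : F) := by rw [← sq, hc]; exact eq_ratCast _ c
  set u : M := ⟨0, θ⟩ with hudef
  have hu : u * u = (c * (m : ℚ)) • (1 : M) + (0 : ℚ) • u := by
    rw [zero_smul, add_zero, Algebra.smul_def, mul_one]
    have h1 : u * u = algebraMap F M ((m : F) * θ * θ) := quadAlg_mk_zero_mul_mk_zero (m : F) θ θ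
    have h2 : (m : F) * θ * θ = algebraMap ℚ F (c * m) := by
      rw [mul_assoc, hθθ, map_mul, eq_ratCast (algebraMap ℚ F) c, map_intCast, mul_comm]
    rw [h1, h2, ← IsScalarTower.algebraMap_apply ℚ F M]
  let φ : F₁ →ₐ[ℚ] M := QuadraticAlgebra.lift ⟨u, hu⟩
  letI : Algebra F₁ M := φ.toRingHom.toAlgebra
  haveI : IsScalarTower ℚ F₁ M := IsScalarTower.of_algebraMap_eq fun r ↦ (φ.commutes r).symm
  have hφ : ∀ z : F₁, algebraMap F₁ M z = z.re • (1 : M) + z.im • u := fun z ↦ rfl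
  have hF₁M : Module.finrank F₁ M = 2 := by
    have h1 := Module.finrank_mul_finrank ℚ F₁ M
    have h2 := Module.finrank_mul_finrank ℚ F M
    rw [hF₁2] at h1
    rw [hF2, hFM] at h2
    omega
  have hμF₁ : μ ∉ Set.range (algebraMap F₁ M) := by
    rintro ⟨z, hz⟩
    rw [hφ] at hz
    -- `(z.im : F) * θ = 1`, so `θ ∈ ℚ`
    have him : (z.im : F) * θ = 1 := by
      rw [← quadAlg_im_smul_one_add_smul_mk (m : F) z.re z.im θ]
      exact congrArg QuadraticAlgebra.im hz
    apply hθ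
    refine ⟨(z.im)⁻¹, ?_⟩
    rw [map_inv₀, eq_ratCast]
    exact (eq_inv_of_mul_eq_one_right him).symm
  -- (5) the Galois side conditions
  set e := absEmbedding ℚ F with hedef
  have he := mem_range_absGaloisRestrict_iff_smul_absEmbedding ℚ F
  set e₁ := absEmbedding ℚ F₁ with he₁def
  have he₁ := mem_range_absGaloisRestrict_iff_smul_absEmbedding ℚ F₁
  have heθ0 : e θ ≠ 0 := (map_ne_zero_iff _ e.toRingHom.injective).mpr hθ0
  have heθsq : e θ ^ 2 = (c : AlgebraicClosure ℚ) := by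
    rw [← map_pow, hc, eq_ratCast (algebraMap ℚ F) c, map_ratCast]
  have he₁sq : e₁ θ₁ ^ 2 = (c : AlgebraicClosure ℚ) * (m : AlgebraicClosure ℚ) := by
    rw [← map_pow, hθ₁sq, eq_ratCast (algebraMap ℚ F₁) (c * m), map_ratCast, Rat.cast_mul,
      Rat.cast_intCast]
  have hAc0 : (c : AlgebraicClosure ℚ) ≠ 0 := Rat.cast_ne_zero.mpr hc0
  set s : AlgebraicClosure ℚ := e₁ θ₁ * (e θ)⁻¹ with hsdef
  have hs : s ^ 2 = (m : AlgebraicClosure ℚ) := by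
    rw [hsdef, mul_pow, inv_pow, heθsq, he₁sq, mul_comm (c : AlgebraicClosure ℚ),
      mul_inv_cancel_right₀ hAc0]
  have hprod : e θ * e₁ θ₁ = s * (c : AlgebraicClosure ℚ) := by
    rw [hsdef, ← heθsq, sq, mul_assoc, inv_mul_cancel_left₀ heθ0, mul_comm]
  have hI : ∀ 𝔓 ∈ v.primesAbove, 𝔓.inertia (absoluteGaloisGroup ℚ) ⊓ (absGaloisRestrict ℚ F₁).range ≤
      (absGaloisRestrict ℚ F).range := by
    intro 𝔓 h𝔓
    haveI : 𝔓.IsPrime := h𝔓.1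
    have hvv : v.asIdeal.under (𝓞 ℚ) = v.asIdeal := Ideal.ext fun _ ↦ Iff.rfl
    have hS : ∀ g ∈ 𝔓.inertia (absoluteGaloisGroup ℚ), g • (e θ * e₁ θ₁) = e θ * e₁ θ₁ := by
      intro g hg
      have hgs : g • s = s := smul_eq_self_of_mem_inertia_of_sq_eq hmk hs (hmP hvv 𝔓 h𝔓) hg
      rw [hprod, smul_mul', hgs, absoluteGaloisGroup.smul_def g (c : AlgebraicClosure ℚ),
        map_ratCast]
    rw [← inf_range_absGaloisRestrict_eq_of_smul_mul_eq hF2 hθ he hF₁2 hθ₁ he₁ hS]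
    exact inf_le_right
  have hg' : ∃ g : absoluteGaloisGroup ℚ, g ∉ (absGaloisRestrict ℚ F₁).range ∧
      FramedRep.trace ρ g ≠ 0 := by
    refine ⟨absGaloisRestrict ℚ F γ, fun hmem ↦ ?_, hγtr⟩
    have h1 : absGaloisRestrict ℚ F γ • e₁ θ₁ = e₁ θ₁ := ((he₁ _).mp hmem) θ₁
    have h2 : absGaloisRestrict ℚ F γ • e θ = e θ := absGaloisRestrict_smul_absEmbedding ℚ F γ θ
    have h3 : absGaloisRestrict ℚ F γ • s = s := by rw [hsdef, smul_mul', smul_inv'', h1, h2]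
    have h4 := absGaloisRestrict_apply_smul ℚ F γ s
    rw [h3] at h4
    -- `γ` fixes the square root `ι(s)` of `m` in `F̄`, but negates `t j`
    have h5 : (absClosureEmbedding ℚ F s) ^ 2 = t j ^ 2 := by
      rw [← map_pow, hs, map_intCast, htj]
    exact absoluteGaloisGroup.smul_ne_of_smul_eq_neg (ht0 j) hγt h5 h4.symm
  have hγM : ∃ γ' : absoluteGaloisGroup F, γ' ∉ (absGaloisRestrict F M).range ∧
      FramedRep.trace (ρ.restrictField F) γ' ≠ 0 := by
    refine ⟨γ, fun hmem ↦ ?_, hγtr⟩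
    have h1 : γ • absEmbedding F M μ = absEmbedding F M μ :=
      ((mem_range_absGaloisRestrict_iff_smul_absEmbedding F M γ).mp hmem) μ
    have h5 : (absEmbedding F M μ) ^ 2 = t j ^ 2 := by
      rw [← map_pow, hμsq, map_intCast, htj]
    exact absoluteGaloisGroup.smul_ne_of_smul_eq_neg (ht0 j) hγt h5 h1
  have hwM : Algebra.IsUnramifiedIn (𝓞 M) w.asIdeal :=
    isUnramifiedIn_of_sq_eq_intCast (K := F) M hFM hμF hmk hμsq w (fun 𝔓 h𝔓 ↦ hmP rfl 𝔓 h𝔓)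
  have huM : ∀ u₁ : HeightOneSpectrum (𝓞 F₁), u₁.asIdeal.under (𝓞 ℚ) = v.asIdeal →
      Algebra.IsUnramifiedIn (𝓞 M) u₁.asIdeal := fun u₁ hu₁ ↦
    isUnramifiedIn_of_sq_eq_intCast (K := F₁) M hF₁M hμF₁ hmk hμsq u₁ (fun 𝔓 h𝔓 ↦ hmP hu₁ 𝔓 h𝔓)
  -- (6) conclusion
  exact Langlands1980_quadraticBaseChange_frobCompatible_at_of_auxField hCar h27 hArch hBCc hACu hF2
    hFK ι π hT hTL hTR ρ hirr hρ P hBC w hwp hunr F₁ hF₁2 hF₁R M hFM hF₁M hI huniq hg' hγM hwM huM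

include hCar in
/-- **Case A of the residue with the unramified strong lifting only** (variant of
`Langlands1980_quadraticBaseChange_frobCompatible_at_of_isUnramifiedIn` of `…CarayolProofs` using
`ArthurClozel1989_strongLifting_unramified` (i) instead of `…_allFinite`): with the data of the fact,
if `ℓ = w ∩ ℤ` is UNRAMIFIED in `F` then the conclusion holds at `w`.  `ρ` is unramified at `ℓ`
(Galois descent along the Galois `F/ℚ`), so by Carayol's clause (C) over `ℚ` the twist
`π ⊗ |det|^{1/2}`, hence `π`, is unramified at `ℓ`; lang.S27 over `ℚ` gives the Frobenius polynomial
of `ρ` at `ℓ`, which ascends to `w` (`hasFrobCharpolyAt_restrictField_arithFrobPolyOfSatake`), and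
the relation (1.1) at `w ∣ ℓ`, `ℓ` unramified in `F`, gives `t_{P,w} = t_{π,ℓ}^{f(w|ℓ)}`.
[cite: CarayolASENS1986, Thm. (A) (pp. 410–411) with §0.5]
[cite: ArthurClozelAMS120, Ch. 3 Thm. 5.1 with §1 (1.1) and Def. 1.2]
[cite: HarrisLanTaylorThorneRMS2016, Thm. A] -/
theorem Langlands1980_quadraticBaseChange_frobCompatible_at_of_isUnramifiedIn'
    (h27 : exists_galoisRep_of_regularAlgebraic) (hACu : ArthurClozel1989_strongLifting_unramified)
    (hF2 : Module.finrank ℚ F = 2) (ι : PadicAlgCl p ≃+* ℂ)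
    (π : CuspidalAutomorphicRepData 2 ℚ hQ) {T : InfinityType ℚ 2} (hT : π.1.HasInfinityType T)
    (hTL : T.IsLAlgebraic) (hTR : T.IsRegular) (ρ : FramedGaloisRep ℚ (PadicAlgCl p) 2)
    (hirr : ρ.toGaloisRep.IsIrreducible)
    (hρ : ∀ᶠ v : HeightOneSpectrum (𝓞 ℚ) in cofinite,
      ∃ α : Multiset ℂ, π.1.HasSatakeParamAt v α ∧ ρ.IsUnramifiedAt v ∧
        ρ.HasFrobCharpolyAt v (arithFrobPolyOfSatake ι v.residueCard 1 α))
    (P : CuspidalAutomorphicRepData 2 F hF) (hBC : IsWeakBaseChangeLiftAE π.1 P.1)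
    (w : HeightOneSpectrum (𝓞 F)) (hwp : (p : 𝓞 F) ∉ w.asIdeal)
    (hℓF : Algebra.IsUnramifiedIn (𝓞 F) (w.under (𝓞 ℚ)).asIdeal)
    (hunr : (ρ.restrictField F).IsUnramifiedAt w) :
    ∃ α : Multiset ℂ, P.1.HasSatakeParamAt w α ∧ (ρ.restrictField F).IsUnramifiedAt w ∧
      (ρ.restrictField F).HasFrobCharpolyAt w (arithFrobPolyOfSatake ι w.residueCard 1 α) := by
  haveI : Algebra.IsQuadraticExtension ℚ F := ⟨hF2⟩
  haveI : IsGalois ℚ F := inferInstance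
  have hprime : (Module.finrank ℚ F).Prime := hF2 ▸ Nat.prime_two
  -- `ρ` is unramified at `ℓ = w ∩ ℤ`
  have hρℓ : ρ.IsUnramifiedAt (w.under (𝓞 ℚ)) :=
    ρ.isUnramifiedAt_of_restrictField_of_under_eq hℓF rfl hunr
  -- Carayol over `ℚ` for the regular algebraic twist `π' = π ⊗ |det|^{1/2}`
  obtain ⟨χ, π', hχ, hW, hW', hT'⟩ := π.exists_twist_hasInfinityType (((2 : ℝ) - 1) / 2) hT
  have hreg' : π'.1.IsRegularAlgebraic :=
    isRegularAlgebraic_of_hasInfinityType_twist_half (n := 2) (by exact_mod_cast hT') hTL hTR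
  have hc : ∀ v : HeightOneSpectrum (𝓞 ℚ), ((p : ℕ) : 𝓞 ℚ) ∉ v.asIdeal →
      IsGaloisCompatibleAt π'.1 ι ρ v := fun v hv ↦
    isGaloisCompatibleAt_halfTwist_of_eventually_of_isIrreducible (n := 2) h27
      (Or.inl inferInstance) ι π hT hTL hTR ρ hirr hρ (by exact_mod_cast hχ) hW hW' hv
  have hπ'ℓ : π'.1.IsUnramifiedAt (w.under (𝓞 ℚ)) :=
    hCar hQ inferInstance π' hreg' p ι ρ hirr hc _ (natCast_not_mem_under'' hwp) hρℓ
  obtain ⟨α, hα⟩ : π.1.IsUnramifiedAt (w.under (𝓞 ℚ)) :=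
    (isUnramifiedAt_iff_of_twist hχ hW hW' _).mp hπ'ℓ
  -- lang.S27 over `ℚ` at `ℓ`, then up to `w` with the relation (1.1)
  obtain ⟨hur, hch⟩ := hasFrobCharpolyAt_one_of_eventually_of_exists_galoisRep_of_isIrreducible h27
    (Or.inl inferInstance) ι π hT hTL hTR ρ hirr hρ (natCast_not_mem_under'' hwp) hα
  exact ⟨_, (hACu.isUnramifiedBaseChangeLift hprime hBC).hasSatakeParamAt w hℓF hα,
    hasFrobCharpolyAt_restrictField_arithFrobPolyOfSatake (L := F) ι ρ (v := w.under (𝓞 ℚ))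
      (w := w) rfl hur 1 hch⟩

include hCar in
/-- **`Langlands1980_quadraticBaseChange_frobCompatible`, granted Carayol's ramification clause and
the base-change / reciprocity named facts.**  The named fact of `QuadraticBaseChangeFrobCompatible`
follows from: Carayol's theorem, ramification clause (C) (the inline hypothesis `hCar`: Carayol
1986, Thm. (A) with §0.5; Taylor, Jarvis 1997 Thm. 7.2 in even degree) together with the named
facts lang.S27 (`exists_galoisRep_of_regularAlgebraic`), Arthur–Clozel's strong lifting at the
archimedean places and at the finite places unramified in the extension
(`ArthurClozel1989_strongLifting_archimedean`, `ArthurClozel1989_strongLifting_unramified`), and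
cuspidal cyclic base change (`baseChange_cyclic_cuspidal`).  Case A (`ℓ = w ∩ ℤ` unramified in `F`)
is `Langlands1980_quadraticBaseChange_frobCompatible_at_of_isUnramifiedIn'`; Case B (`ℓ` ramified
in `F`) is `Langlands1980_quadraticBaseChange_frobCompatible_at_of_not_isUnramifiedIn`.
[cite: LanglandsBaseChange1980, §2 (A), (F) (pp. 19–20) with (i) (p. 13)]
[cite: CarayolASENS1986, Thm. (A) (pp. 410–411) with §0.5]
[cite: ArthurClozelAMS120, Ch. 3 Thm. 4.2 (a), Thm. 5.1] [cite: HarrisLanTaylorThorneRMS2016, Thm. A] -/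
theorem Langlands1980_quadraticBaseChange_frobCompatible_of_carayol
    (h27 : exists_galoisRep_of_regularAlgebraic) (hArch : ArthurClozel1989_strongLifting_archimedean)
    (hBCc : baseChange_cyclic_cuspidal) (hACu : ArthurClozel1989_strongLifting_unramified) :
    Langlands1980_quadraticBaseChange_frobCompatible := by
  unfold Langlands1980_quadraticBaseChange_frobCompatible
  intro F _ _ hF2 p _ ι hQ hF π T hT hTL hTR ρ hirr hρ P hBC w hwp hunr
  by_cases hram : Algebra.IsUnramifiedIn (𝓞 F) (w.under (𝓞 ℚ)).asIdeal
  · exact Langlands1980_quadraticBaseChange_frobCompatible_at_of_isUnramifiedIn' hCar h27 hACu hF2 ι π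
      hT hTL hTR ρ hirr hρ P hBC w hwp hram hunr
  · exact Langlands1980_quadraticBaseChange_frobCompatible_at_of_not_isUnramifiedIn hCar h27 hArch
      hBCc hACu hF2 ι π hT hTL hTR ρ hirr hρ P hBC w hwp hram hunr

end CaseB

end Literature.NumberTheory.Automorphic

end
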